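import Literature.MathematicalPhysics.QuantumFieldTheory.Balaban1983to89.B9SectBGWordGradDivY
import Literature.MathematicalPhysics.QuantumFieldTheory.Balaban1983to89.B9Eq371GradLetters

/-!
# Balaban [B9], (3.3) p. 390, (3.8) p. 392, (3.42) p. 397 — NODE 00's bond-sector covariant differences `∇_{U,μ}` (`cdB`), `∇*_{U,μ}` (`cdsB`) ARE
# r06's difference letters `diffLetter (bT T) (bU V) c (inl μ ∕ inr μ)` ON THE BOND CARRIER IN COORDINATES: `bondFunCoordsY_cdB`, `bondFunCoordsY_cdsB`
# (pub-ymgap N06 G-side plan, Route L — the letters of the (3.42) entries `∇G`, `G∇*` in the G frames' `readG342 ∕ writeG342`)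

T. Bałaban, *Propagators for lattice gauge theories in a background field*, Commun. Math. Phys. **99** (1985) 389–434
[`Balaban1985BackgroundPropagators`, "B9"].

statement-level skeleton of published theorems with citation tags; proofs where landed; nothing here is a claim about the
Yang–Mills mass gap

THE PRINTED LOCI.  (3.3) p. 390 and p. 391 («we identify a function A on bonds with the vector function A_μ(x)»); (3.8) p. 392; (3.39) p. 397 (`∇_U` on
the bond sector); (3.42) p. 397 (the entries `∇_UG`, `G∇*_U`).

WHY THIS FILE (seat dag-n06-c gen 13; G-SIDE-PLAN v2, Route L).  The G frames (`B9SectBGFrameV4.GFrame₄`) read and write the (3.42) entries of `G(·)` as block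
majorants of `conj b (diffLetter (bT (T i)) (bU (coord i U)) η⁻¹ k) * Gb` and `Gb * conj b (diffLetter … k)`, `k : κ ⊕ κ` (r06 `B9Eq352GradLetters.diffLetter`:
`inl μ ↦ c•D_μ`, `inr μ ↦ −c•D*_μ` along the shifts `bT T μ = id × T μ` and the background `bU V μ (κ′, z) = V μ z` of the bond carrier — `B9Eq371GradLetters`),
whereas gen 12's READ ∕ WRITE dictionary for `KACU` (`B9SectBGReadY`) speaks NODE 00's `cdBₗ U μ ∘ G`, `G ∘ cdsBₗ U μ` on `FBondY → 𝔸`.  THIS FILE identifies the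
two, exactly, for EVERY `U`, `μ`, `A`, `𝔸`: in the bond coordinates `bondFunCoordsY` of `Node00/OpsYBondCoords`, `cdB U μ` IS `diffLetter (bT shiftY) (bU (UboxY
U)) c_f (inl μ)` and `cdsB U μ` IS `gradLetterB (bT shiftY) (bU (UboxY U)) c_f μ = −diffLetter … (inr μ)` (same constant `c_f`; the frames put `η⁻¹ = |c_f|`).

HONEST SCOPE.  Exact identities between DEFINED objects; no estimate; nothing of [B9] asserted; count-neutral; N06 NOT discharged; nothing continuum ∕ OS ∕
mass-gap ∕ Clay.  No `sorry`, no `axiom`, no `def`, no `instance`.  `--supports stmt-QuantumFields-27364`.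

RELATED IN THE TREE, NOT DUPLICATED: `B9SectBGWordGradDivY` (the site-to-bond letters `D_U ∕ D*_U`, gen 13 — same method), `Node00.OpsYCurlGrad.cdB_gradY_apply`
(def-Y: `cdB` on torus coordinates, pointwise), `B9Eq352GradLetters` ∕ `B9Eq371GradLetters` (r06's letters — USED).
-/

noncomputable section

namespace Literature.MathematicalPhysics.QuantumFieldTheory.Balaban1983to89.B9SectBGWordDiffY

open Literature.MathematicalPhysics.QuantumFieldTheory.Balaban1983to89
open Literature.MathematicalPhysics.QuantumFieldTheory.Balaban1983to89.B6KLevelCensusIndexV1 (KIdx)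
open Literature.MathematicalPhysics.QuantumFieldTheory.Balaban1983to89.B9Eq39Adjoint (R covD covDstar)
open Literature.MathematicalPhysics.QuantumFieldTheory.Balaban1983to89.B9Eq352DivFormLetters (gradLetterF gradLetterB gradLetterF_apply gradLetterB_apply)
open Literature.MathematicalPhysics.QuantumFieldTheory.Balaban1983to89.B9Eq352GradLetters (diffLetter diffLetter_inl diffLetter_inr)
open Literature.MathematicalPhysics.QuantumFieldTheory.Balaban1983to89.B9Eq371GradLetters (bT bU bT_apply bU_apply)
open Literature.MathematicalPhysics.QuantumFieldTheory.Balaban1983to89.Node00 (SiteY FBondY CfgY UboxY shiftY cdB cdsB bondCoordsY bondFunCoordsY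
  bondFunCoordsY_apply bondCoordsY_symm_mk bondFunCoordsY_apply_bondCoordsY)
open Literature.MathematicalPhysics.QuantumFieldTheory.Balaban1983to89.Node00.OpsYNablaBridge (chartY chartY_eq shiftY_chartY shiftY_symm_chartY)

variable {𝔸 : Type} [NormedRing 𝔸] [NormedAlgebra ℂ 𝔸] [CompleteSpace 𝔸]
variable {d ℓ : ℕ} {hd : 1 ≤ d + 1} {hL : Odd (ℓ + 1) ∧ 1 < ℓ + 1} {b₀ b₁ : ℝ}
variable (i : KIdx d ℓ hd hL b₀ b₁)

/-- ★ **(3.3)∕(3.39) — `∇_{U,μ}` on the bond sector IS r06's forward difference letter in bond coordinates**: for every `U`, `μ`, `A`: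
`bondFunCoordsY (cdB U μ A) = gradLetterF (bT shiftY) (bU (UboxY U)) c_f μ (bondFunCoordsY A) = diffLetter … c_f (inl μ) (bondFunCoordsY A)`.
[cite: Balaban1985BackgroundPropagators, (3.3) p.390, (3.39) p.397] -/
theorem bondFunCoordsY_cdB (U : CfgY 𝔸 i) (μ : Fin (d + 1)) (A : FBondY i → 𝔸) :
    bondFunCoordsY i (cdB i U μ A) = diffLetter (bT (shiftY i)) (bU (UboxY i U)) ((i.cf : ℝ) : ℂ) (Sum.inl μ) (bondFunCoordsY i A) := by
  funext p
  obtain ⟨κ', z⟩ := p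
  obtain ⟨s, rfl⟩ := (chartY i).surjective z
  -- both sides are `c_f • (R(U_μ(s)) A⟨s + e_μ, κ′⟩ − A⟨s, κ′⟩)`
  have e1 : (B9BackgroundsKLevelV1.shiftsV1 (B6GlobalChartV1.PV d ℓ i.m i.K hd hL) μ) s = s.shift μ := rfl
  have hsymm : ∀ x, (B6GlobalChartV1.boxEquiv i.hN).symm (chartY i x) = x := fun x => by
    rw [← chartY_eq]; exact Equiv.symm_apply_apply _ _
  have hU : UboxY i U μ (chartY i s) = U μ s := by
    show U μ ((B6GlobalChartV1.boxEquiv i.hN).symm (chartY i s)) = U μ s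
    rw [hsymm]
  rw [bondFunCoordsY_apply, bondCoordsY_symm_mk, hsymm, diffLetter_inl, gradLetterF_apply, covD, bT_apply, bU_apply, bondFunCoordsY_apply,
    bondFunCoordsY_apply, bondCoordsY_symm_mk, bondCoordsY_symm_mk, hsymm, shiftY_chartY, hsymm, hU]
  simp only [cdB, covD, e1]

/-- ★ **(3.8) — `∇*_{U,μ}` on the bond sector IS r06's backward difference letter in bond coordinates**: for every `U`, `μ`, `A`:
`bondFunCoordsY (cdsB U μ A) = gradLetterB (bT shiftY) (bU (UboxY U)) c_f μ (bondFunCoordsY A)` (`= −diffLetter … c_f (inr μ) (bondFunCoordsY A)`).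
[cite: Balaban1985BackgroundPropagators, (3.8) p.392, (3.42) p.397] -/
theorem bondFunCoordsY_cdsB (U : CfgY 𝔸 i) (μ : Fin (d + 1)) (A : FBondY i → 𝔸) :
    bondFunCoordsY i (cdsB i U μ A) = gradLetterB (bT (shiftY i)) (bU (UboxY i U)) ((i.cf : ℝ) : ℂ) μ (bondFunCoordsY i A) := by
  funext p
  obtain ⟨κ', z⟩ := p
  obtain ⟨s, rfl⟩ := (chartY i).surjective z
  -- both sides are `c_f • (R(U_μ(s − e_μ))⁻¹ A⟨s − e_μ, κ′⟩ − A⟨s, κ′⟩)`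
  have e1 : (B9BackgroundsKLevelV1.shiftsV1 (B6GlobalChartV1.PV d ℓ i.m i.K hd hL) μ).symm s = s.unshift μ := rfl
  have hsymm : ∀ x, (B6GlobalChartV1.boxEquiv i.hN).symm (chartY i x) = x := fun x => by
    rw [← chartY_eq]; exact Equiv.symm_apply_apply _ _
  have hT : (bT (shiftY i) μ).symm (κ', chartY i s) = (κ', chartY i (s.unshift μ)) := by
    rw [← shiftY_symm_chartY]; rfl
  have hU : UboxY i U μ (chartY i (s.unshift μ)) = U μ (s.unshift μ) := by
    show U μ ((B6GlobalChartV1.boxEquiv i.hN).symm (chartY i (s.unshift μ))) = U μ (s.unshift μ)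
    rw [hsymm]
  rw [bondFunCoordsY_apply, bondCoordsY_symm_mk, hsymm, gradLetterB_apply, covDstar, hT, bU_apply, bondFunCoordsY_apply, bondFunCoordsY_apply,
    bondCoordsY_symm_mk, bondCoordsY_symm_mk, hsymm, hsymm, hU]
  simp only [cdsB, covDstar, e1]

/-- the `inr` form: `bondFunCoordsY (cdsB U μ A) = −(diffLetter (bT shiftY) (bU (UboxY U)) c_f (inr μ) (bondFunCoordsY A))`.
[cite: Balaban1985BackgroundPropagators, (3.8) p.392, (3.42) p.397] -/
theorem bondFunCoordsY_cdsB_inr (U : CfgY 𝔸 i) (μ : Fin (d + 1)) (A : FBondY i → 𝔸) :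
    bondFunCoordsY i (cdsB i U μ A) = -(diffLetter (bT (shiftY i)) (bU (UboxY i U)) ((i.cf : ℝ) : ℂ) (Sum.inr μ) (bondFunCoordsY i A)) := by
  rw [diffLetter_inr, LinearMap.neg_apply, neg_neg, bondFunCoordsY_cdsB]

end Literature.MathematicalPhysics.QuantumFieldTheory.Balaban1983to89.B9SectBGWordDiffY

end
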